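import Summits.QuantumFields.YangMills.Theorems.BalabanUVNodesN16Thm4OutputLandau138
import Summits.QuantumFields.YangMills.Theorems.BalabanUVNodesN16HolderMSPairDefs
import HarnessLib

/-!
# Route «BalabanUVNodes», cluster K4 «SpineRates» — node N16 = NE3: (OUT₁₃₈-MS) ⟹ (OUT-MS) ⟹ `PairLandauGaugeB8AvgMS` — the two upper member dictionaries of
# the N05 → N16 edge WITH THE MULTI-SCALE (3.40) HÖLDER MEMBER carried on the same representative (repair R-β″, PRODUCER HALF; twins of n16-a's files 7 §1 ∕ 9 §1)

Cell `pub-ymgap`, seat `pub-ymgap-dag-n16-c` (R134 fan-out seat, strategy s1; HUMAN RULING D-0062; chair R424 venue), generation 4, file 30.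
`--supports stmt-QuantumFields-19912 --as helper` (K3‴ `SpineGivenEndpointR13`, route rev 16).  `bears_on: R4∕N16 · edge N05 → N16`.  Located item:
`HOME/pub-ymgap-dag-n16-c/LOCATED-N16-HOLDER-PIN.md`, census row R-β″ (ADDENDUM 5); below it: file 29 `N16HolderMSPrintLetters` ((OUT_print-MS) ⟹ (OUT₁₃₈-MS));
above it: files 25–28 (THE END with the multi-scale member ⟹ `CovRootHolderMS`).

WHY.  n16-a's (OUT) ∕ (OUT₁₃₈) binders carry THE END's nearest-neighbour member of `Z = Ad_{W⁻¹}(iηA)`; their multi-scale companions (OUT-MS) ∕ (OUT₁₃₈-MS) carry, in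
addition, THE END's multi-scale member of the SAME `Z` (the body of file 26's `PairLandauGaugeB8AvgMS` in these letters).  n16-a's two dictionaries touch neither
member: file 9 §1 converts only the Landau conjunct, file 7 §1 builds `LandauRepB8Avg` for the representative `(u⁻¹·u₀, Z)` with THE SAME `Z`.  So both pass the
multi-scale member through verbatim; the output of §2 is `PairLandauGaugeB8AvgMS`, the hypothesis of THE END's junction (file 25).

WHAT THIS FILE PROVES (kernel, theorems only, 0 `def`, 0 sorry): §1 `thm4OutputMS_of_thm4OutputLandau138MS`; §2 `pairLandauGaugeB8AvgMS_of_thm4OutputMS`;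
§3 `pairLandauGaugeB8AvgMS_of_thm4OutputLandau138MS` (composition).
HONEST FRAMING: bookkeeping over LANDED theorems by name; (OUT-MS) ∕ (OUT₁₃₈-MS) are [Balaban1985RegularSpaces] Thm 4 ∕ Prop 3 OUTPUT TYPES at curved backgrounds (node
N05) — NOT proved; (H3ˢᵘᵖ) = N07's TYPE; N16 ∕ NE3 NOT discharged; count-neutral; one finite four-torus at fixed ε — NOT ℝ⁴, NOT infinite volume, NOT OS, NOT a mass gap,
NOT Clay.
-/

set_option autoImplicit false

open scoped BigOperators Matrix Matrix.Norms.L2Operator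
open NormedSpace

namespace Summit.QuantumFields.YangMills.BalabanUVNodes.N16HolderMSOutputDict

open Literature.MathematicalPhysics.QuantumFieldTheory.Balaban1983to89
open B7Prop1Explicit B7Prop2Explicit
open T4AveragingDeficitWall (IsUnitaryCfg SmallField Ad IsSkewDir vary)
open T4AveragingDeficitWallBoundary (IsPeriodicCfg periodBox)
open B8Lemma1NonAbelian (pert)
open B7Eq92Concrete (mgauge)
open B8Ineq132 (covDerivFwd)
open B8Eq146AExpansion (iEta)
open B8Eq184Proof (cfgExp)
open B8Eq119TwistedAxial (Restr129)
open B8Eq166ConstraintPair (ptw ptw_periodic pinnedTwistedFix_global)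
open B8Eq138LandauZd (IsLandau138)
open B8Thm4TorusAt (torusLam)
open B12Ineq417Flat (shiftCfg)
open Summit.QuantumFields.BalabanUV.T4Continuum
open AveragingDeficitPeriodicCounting (IsPeriodicDir)
open MinimalActionSandwich (IsMinimiser)
open MinimalActionRate (Regular sfClass rescale_bavg_mem_sfClass)
open MinimalActionRefine (RegularSup)
open NE3EnergyShapes (IsUnitarySite IsPeriodicSite)
open NE3.PairLandauB8 (LandauRepB8 IsLandauB8 covLapDir)
open NE3.PairLandauB8Avg (PairLandauGaugeB8Avg)
open NE3.LeafIndexSockets (LeafH3sup)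
open NE3.RemainderTowerPrepB8 (shiftCfg_of_isPeriodicCfg)
open NE3.SupplierB8SfClassPrep (pdev_le_of_smallField)
open NE3.PairDbarB8 (dbar_of_restr129_pair)
open NE3.PairLandau138B8 (isLandauB8_of_isLandau138_torus)
open N16 (landauRepB8_of_leftChart)
open N16HolderMSPairDefs (PairLandauGaugeB8AvgMS)

noncomputable section

variable {d : ℕ} {n : Type*} [Fintype n] [DecidableEq n]

/-! ## §1 (OUT₁₃₈-MS) ⟹ (OUT-MS) -/

/-- **(OUT₁₃₈-MS) ⟹ (OUT-MS)** — n16-a's `N16.thm4Output_of_thm4OutputLandau138` (file 9 §1: node N05's multiplier-form (1.38) ⟹ THE END's `IsLandauB8` by n16-b's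
`PairLandau138B8.isLandauB8_of_isLandau138_torus`) with THE END's multi-scale member of `Z = Ad_{W⁻¹}(iηA)` carried beside the nearest-neighbour one; every other
conjunct and the proof unchanged. [cite: Balaban1985RegularSpaces, (1.36)–(1.38) p.82; Balaban1985BackgroundPropagators, (3.40) p.397] [folklore] -/
theorem thm4OutputMS_of_thm4OutputLandau138MS [Nonempty n] {L N : ℕ} (hL : 2 ≤ L) (hN : 1 ≤ N) {ε b g α s g' s₂ s₃ β : ℝ}
    (hb : 0 ≤ b) (hbs : 512 * (d + 1) * (d + 4) * (L : ℝ) ^ 2 * b ≤ 1)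
    (hbα : b + 226 * (8 * (d + 1) * (d + 4)) ^ 2 * b ^ 2 < α)
    (hα : 0 < α) (hα3 : C0 d * α ≤ 1 / 3) (hα2 : 2 * α ≤ c2' d L)
    {dom : Set (Site d → Fin d → (Matrix n n ℂ)ˣ)}
    (hOut : ∀ k : ℕ, 1 ≤ k → ∀ V ∈ dom, ∀ UA UB : Site d → Fin d → (Matrix n n ℂ)ˣ,
      IsMinimiser d (sfClass d L N ε) L N k V UA → IsMinimiser d (sfClass d L N ε) L N (k + 1) V UB → Regular d L N b g (k + 1) UB →
      ∃ u : Site d → (Matrix n n ℂ)ˣ, (∀ x, u x ∈ unitaryUnits (Matrix n n ℂ)) ∧ IsPeriodicSite u ((N * L ^ k : ℕ) : ℤ) ∧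
        (∃ Λ : ℕ → Set (Site d), Λ k = Set.univ ∧ Restr129 L k Λ (rescale L (bavg L UB)) u) ∧
        ∃ A : Site d → Fin d → Matrix n n ℂ,
          (∀ x μ, IsSelfAdjoint (A x μ)) ∧ (∀ (x : Site d) (κ μ : Fin d), A (x + ((N * L ^ k : ℕ) : ℤ) • e κ) μ = A x μ) ∧
          mgauge (rescale L (bavg L UB)) u (cfgExp (((L : ℝ) ^ k)⁻¹) A)
            = pert (gaugeAct (ptw L (rescale L (bavg L UB)) UA k) UA) (rescale L (bavg L UB)) ∧
          (∀ x μ, ‖A x μ‖ ≤ s) ∧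
          (∀ (μ : Fin d) (x : Site d) (κ : Fin d), ‖covDerivFwd (((L : ℝ) ^ k)⁻¹) (rescale L (bavg L UB)) μ (fun z => A z κ) x‖ ≤ g') ∧
          IsLandau138 L k (((L : ℝ) ^ k)⁻¹) Set.univ (torusLam k) (rescale L (bavg L UB)) A ∧
          (∀ (κ μ : Fin d) (y : Site d),
            ‖Ad (rescale L (bavg L UB) (y + e κ) μ)
                (Ad (rescale L (bavg L UB) (y + e κ + e μ) μ)
                    ((fun x μ => Ad (rescale L (bavg L UB) x μ)⁻¹ (iEta (((L : ℝ) ^ k)⁻¹) A x μ)) (y + (2 : ℕ) • e μ) κ)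
                  - (fun x μ => Ad (rescale L (bavg L UB) x μ)⁻¹ (iEta (((L : ℝ) ^ k)⁻¹) A x μ)) (y + e μ) κ)
              - (Ad (rescale L (bavg L UB) (y + e κ) μ) ((fun x μ => Ad (rescale L (bavg L UB) x μ)⁻¹ (iEta (((L : ℝ) ^ k)⁻¹) A x μ)) (y + e μ) κ)
                - (fun x μ => Ad (rescale L (bavg L UB) x μ)⁻¹ (iEta (((L : ℝ) ^ k)⁻¹) A x μ)) y κ)‖
              ≤ s₂ * (((L : ℝ)⁻¹) ^ k) ^ ((2 : ℝ) + β)) ∧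
          (∀ (κ μ : Fin d) (y : Site d) (j : ℕ), 1 ≤ j → j ≤ L ^ k →
            ‖Ad (((List.range j).map fun i : ℕ => rescale L (bavg L UB) (y + e κ + i • e μ) μ).prod)
                  (Ad (rescale L (bavg L UB) (y + e κ + j • e μ) μ)
                      ((fun x μ => Ad (rescale L (bavg L UB) x μ)⁻¹ (iEta (((L : ℝ) ^ k)⁻¹) A x μ)) (y + (j + 1) • e μ) κ)
                    - (fun x μ => Ad (rescale L (bavg L UB) x μ)⁻¹ (iEta (((L : ℝ) ^ k)⁻¹) A x μ)) (y + j • e μ) κ)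
              - (Ad (rescale L (bavg L UB) (y + e κ) μ) ((fun x μ => Ad (rescale L (bavg L UB) x μ)⁻¹ (iEta (((L : ℝ) ^ k)⁻¹) A x μ)) (y + e μ) κ)
                - (fun x μ => Ad (rescale L (bavg L UB) x μ)⁻¹ (iEta (((L : ℝ) ^ k)⁻¹) A x μ)) y κ)‖
              ≤ s₂ * (((L : ℝ)⁻¹) ^ k) ^ ((2 : ℝ) + β) * (j : ℝ) ^ β) ∧
          (∀ (x : Site d) (κ : Fin d),
            ‖covLapDir (rescale L (bavg L UB)) (fun x μ => Ad (rescale L (bavg L UB) x μ)⁻¹ (iEta (((L : ℝ) ^ k)⁻¹) A x μ)) x κ‖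
              ≤ s₃ * (((L : ℝ)⁻¹) ^ k) ^ 3)) :
    ∀ k : ℕ, 1 ≤ k → ∀ V ∈ dom, ∀ UA UB : Site d → Fin d → (Matrix n n ℂ)ˣ,
      IsMinimiser d (sfClass d L N ε) L N k V UA → IsMinimiser d (sfClass d L N ε) L N (k + 1) V UB → Regular d L N b g (k + 1) UB →
      ∃ u : Site d → (Matrix n n ℂ)ˣ, (∀ x, u x ∈ unitaryUnits (Matrix n n ℂ)) ∧ IsPeriodicSite u ((N * L ^ k : ℕ) : ℤ) ∧
        (∃ Λ : ℕ → Set (Site d), Λ k = Set.univ ∧ Restr129 L k Λ (rescale L (bavg L UB)) u) ∧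
        ∃ A : Site d → Fin d → Matrix n n ℂ,
          (∀ x μ, IsSelfAdjoint (A x μ)) ∧ (∀ (x : Site d) (κ μ : Fin d), A (x + ((N * L ^ k : ℕ) : ℤ) • e κ) μ = A x μ) ∧
          mgauge (rescale L (bavg L UB)) u (cfgExp (((L : ℝ) ^ k)⁻¹) A)
            = pert (gaugeAct (ptw L (rescale L (bavg L UB)) UA k) UA) (rescale L (bavg L UB)) ∧
          (∀ x μ, ‖A x μ‖ ≤ s) ∧
          (∀ (μ : Fin d) (x : Site d) (κ : Fin d), ‖covDerivFwd (((L : ℝ) ^ k)⁻¹) (rescale L (bavg L UB)) μ (fun z => A z κ) x‖ ≤ g') ∧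
          IsLandauB8 L N k (rescale L (bavg L UB)) (fun x μ => Ad (rescale L (bavg L UB) x μ)⁻¹ (iEta (((L : ℝ) ^ k)⁻¹) A x μ)) ∧
          (∀ (κ μ : Fin d) (y : Site d),
            ‖Ad (rescale L (bavg L UB) (y + e κ) μ)
                (Ad (rescale L (bavg L UB) (y + e κ + e μ) μ)
                    ((fun x μ => Ad (rescale L (bavg L UB) x μ)⁻¹ (iEta (((L : ℝ) ^ k)⁻¹) A x μ)) (y + (2 : ℕ) • e μ) κ)
                  - (fun x μ => Ad (rescale L (bavg L UB) x μ)⁻¹ (iEta (((L : ℝ) ^ k)⁻¹) A x μ)) (y + e μ) κ)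
              - (Ad (rescale L (bavg L UB) (y + e κ) μ) ((fun x μ => Ad (rescale L (bavg L UB) x μ)⁻¹ (iEta (((L : ℝ) ^ k)⁻¹) A x μ)) (y + e μ) κ)
                - (fun x μ => Ad (rescale L (bavg L UB) x μ)⁻¹ (iEta (((L : ℝ) ^ k)⁻¹) A x μ)) y κ)‖
              ≤ s₂ * (((L : ℝ)⁻¹) ^ k) ^ ((2 : ℝ) + β)) ∧
          (∀ (κ μ : Fin d) (y : Site d) (j : ℕ), 1 ≤ j → j ≤ L ^ k →
            ‖Ad (((List.range j).map fun i : ℕ => rescale L (bavg L UB) (y + e κ + i • e μ) μ).prod)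
                  (Ad (rescale L (bavg L UB) (y + e κ + j • e μ) μ)
                      ((fun x μ => Ad (rescale L (bavg L UB) x μ)⁻¹ (iEta (((L : ℝ) ^ k)⁻¹) A x μ)) (y + (j + 1) • e μ) κ)
                    - (fun x μ => Ad (rescale L (bavg L UB) x μ)⁻¹ (iEta (((L : ℝ) ^ k)⁻¹) A x μ)) (y + j • e μ) κ)
              - (Ad (rescale L (bavg L UB) (y + e κ) μ) ((fun x μ => Ad (rescale L (bavg L UB) x μ)⁻¹ (iEta (((L : ℝ) ^ k)⁻¹) A x μ)) (y + e μ) κ)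
                - (fun x μ => Ad (rescale L (bavg L UB) x μ)⁻¹ (iEta (((L : ℝ) ^ k)⁻¹) A x μ)) y κ)‖
              ≤ s₂ * (((L : ℝ)⁻¹) ^ k) ^ ((2 : ℝ) + β) * (j : ℝ) ^ β) ∧
          (∀ (x : Site d) (κ : Fin d),
            ‖covLapDir (rescale L (bavg L UB)) (fun x μ => Ad (rescale L (bavg L UB) x μ)⁻¹ (iEta (((L : ℝ) ^ k)⁻¹) A x μ)) x κ‖
              ≤ s₃ * (((L : ℝ)⁻¹) ^ k) ^ 3) := by
  intro k hk V hV UA UB hA hB hreg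
  have hL1 : 1 ≤ L := le_trans (by norm_num) hL
  obtain ⟨u, hu, huP, hres, A, hAsa, hAP, hmg, hs, hg, h138, hhol, hMS, hlap⟩ := hOut k hk V hV UA UB hA hB hreg
  -- the background `W = rescale L (bavg L U_B)`: unitary, periodic, small-field of radius `(b + 226(8(d+1)(d+4))²b²)·L^{−2k}`
  have hαb0 : 0 ≤ b + 226 * (8 * (d + 1) * (d + 4)) ^ 2 * b ^ 2 := by positivity
  obtain ⟨hWu, hWP, hWsm⟩ := rescale_bavg_mem_sfClass hL1 hb hbs le_rfl hreg
  have h33 : pdev (rescale L (bavg L UB)) < α * (((L : ℝ) ^ k)⁻¹) ^ 2 := by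
    refine (pdev_le_of_smallField (div_nonneg hαb0 (by positivity)) hWsm).trans_lt ?_
    rw [inv_pow, ← div_eq_mul_inv]; exact div_lt_div_of_pos_right hbα (by positivity)
  -- `A` is periodic (its own conjunct); `η = (Lᵏ)⁻¹ ≠ 0`
  have hAP' : IsPeriodicDir A ((N * L ^ k : ℕ) : ℤ) := fun x κ μ => hAP x κ μ
  have hη : (((L : ℝ) ^ k)⁻¹) ≠ 0 := by positivity
  -- the averaged backgrounds `Ū^j`, `j ≤ k`, stay unitary ([Balaban1985Averaging] Prop. 2's closure property of the unitary group)
  have hWj : ∀ j, j < k → IsUnitaryCfg (avgIter L (rescale L (bavg L UB)) j) := by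
    letI : CStarAlgebra (Matrix n n ℂ) := {}
    have hG := avgClosed_unitaryUnits d (𝔸 := Matrix n n ℂ) L
    intro j hj x κ
    exact avgIter_mem L hL hG k (rescale L (bavg L UB)) hWu hα hα3 hα2 h33 j hj.le x κ
  -- n16-b's dictionary: multiplier form (N05) ⟹ variational form (THE END), torus geometry (`torusLam k` unfolds to its `if`)
  have hlan : IsLandauB8 (d := d) L N k (rescale L (bavg L UB))
      (fun x μ => Ad (rescale L (bavg L UB) x μ)⁻¹ (iEta (((L : ℝ) ^ k)⁻¹) A x μ)) :=
    isLandauB8_of_isLandau138_torus hL1 hN hη hWu hWP hWj hAP' h138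
  exact ⟨u, hu, huP, hres, A, hAsa, hAP, hmg, hs, hg, hlan, hhol, hMS, hlap⟩

/-! ## §2 `PairLandauGaugeB8AvgMS` from (OUT-MS) -/

/-- **`PairLandauGaugeB8AvgMS` FROM [B8] THM 4's OUTPUT AT THE PAIR WITH THE MULTI-SCALE MEMBER** — n16-a's `N16.pairLandauGaugeB8Avg_of_thm4Output` (file 7 §1:
the Landau representative from the left chart `landauRepB8_of_leftChart`, (1.37) from (1.29) `PairDbarB8.dbar_of_restr129_pair`, the pinned axial pre-gauge's regime)
with (OUT-MS) = (OUT) PLUS THE END's multi-scale member of the SAME `Z = Ad_{W⁻¹}(iηA)`; conclusion file 26's `PairLandauGaugeB8AvgMS d (sfClass d L N ε) L N b g s₁ s₂ β dom`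
(the representative `(u⁻¹·u₀, Z)` of n16-a's proof, the member passed through).  No existence is proved: (OUT-MS) is the hypothesis.
[cite: Balaban1985RegularSpaces, Thm 4 p.88, (1.36)–(1.38) p.82; Balaban1985BackgroundPropagators, (3.40) p.397] [folklore] -/
theorem pairLandauGaugeB8AvgMS_of_thm4OutputMS [Nonempty n] (hd : 1 ≤ d) {L N : ℕ} (hL : 2 ≤ L) {ε b g b' c' α s g' s₁ s₂ β : ℝ}
    (hε : 0 ≤ ε) (hb : 0 ≤ b) (hbs : 512 * (d + 1) * (d + 4) * (L : ℝ) ^ 2 * b ≤ 1)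
    (hbα : b + 226 * (8 * (d + 1) * (d + 4)) ^ 2 * b ^ 2 < α)
    (hb' : 0 ≤ b') (hRb : 2 ^ 15 * ((d : ℝ) + 1) ^ 2 * ((d : ℝ) + 4) ^ 2 * (L : ℝ) ^ 2 * b' ≤ 1)
    (hb'α : b' + 226 * (8 * (d + 1) * (d + 4)) ^ 2 * b' ^ 2 < α)
    (hα : 0 < α) (hεα : ε < α) (hα3 : C0 d * α ≤ 1 / 3) (hα2 : 2 * α ≤ c2' d L)
    (hs0 : 0 ≤ s) (hsup : s ≤ s₁) (hgrad : g' + 2 * (b' + 226 * (8 * (d + 1) * (d + 4)) ^ 2 * b' ^ 2) * s ≤ s₁)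
    {dom : Set (Site d → Fin d → (Matrix n n ℂ)ˣ)}
    (hOut : ∀ k : ℕ, 1 ≤ k → ∀ V ∈ dom, ∀ UA UB : Site d → Fin d → (Matrix n n ℂ)ˣ,
      IsMinimiser d (sfClass d L N ε) L N k V UA → IsMinimiser d (sfClass d L N ε) L N (k + 1) V UB → Regular d L N b g (k + 1) UB →
      ∃ u : Site d → (Matrix n n ℂ)ˣ, (∀ x, u x ∈ unitaryUnits (Matrix n n ℂ)) ∧ IsPeriodicSite u ((N * L ^ k : ℕ) : ℤ) ∧
        (∃ Λ : ℕ → Set (Site d), Λ k = Set.univ ∧ Restr129 L k Λ (rescale L (bavg L UB)) u) ∧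
        ∃ A : Site d → Fin d → Matrix n n ℂ,
          (∀ x μ, IsSelfAdjoint (A x μ)) ∧ (∀ (x : Site d) (κ μ : Fin d), A (x + ((N * L ^ k : ℕ) : ℤ) • e κ) μ = A x μ) ∧
          mgauge (rescale L (bavg L UB)) u (cfgExp (((L : ℝ) ^ k)⁻¹) A)
            = pert (gaugeAct (ptw L (rescale L (bavg L UB)) UA k) UA) (rescale L (bavg L UB)) ∧
          (∀ x μ, ‖A x μ‖ ≤ s) ∧
          (∀ (μ : Fin d) (x : Site d) (κ : Fin d), ‖covDerivFwd (((L : ℝ) ^ k)⁻¹) (rescale L (bavg L UB)) μ (fun z => A z κ) x‖ ≤ g') ∧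
          IsLandauB8 L N k (rescale L (bavg L UB)) (fun x μ => Ad (rescale L (bavg L UB) x μ)⁻¹ (iEta (((L : ℝ) ^ k)⁻¹) A x μ)) ∧
          (∀ (κ μ : Fin d) (y : Site d),
            ‖Ad (rescale L (bavg L UB) (y + e κ) μ)
                (Ad (rescale L (bavg L UB) (y + e κ + e μ) μ)
                    ((fun x μ => Ad (rescale L (bavg L UB) x μ)⁻¹ (iEta (((L : ℝ) ^ k)⁻¹) A x μ)) (y + (2 : ℕ) • e μ) κ)
                  - (fun x μ => Ad (rescale L (bavg L UB) x μ)⁻¹ (iEta (((L : ℝ) ^ k)⁻¹) A x μ)) (y + e μ) κ)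
              - (Ad (rescale L (bavg L UB) (y + e κ) μ) ((fun x μ => Ad (rescale L (bavg L UB) x μ)⁻¹ (iEta (((L : ℝ) ^ k)⁻¹) A x μ)) (y + e μ) κ)
                - (fun x μ => Ad (rescale L (bavg L UB) x μ)⁻¹ (iEta (((L : ℝ) ^ k)⁻¹) A x μ)) y κ)‖
              ≤ s₂ * (((L : ℝ)⁻¹) ^ k) ^ ((2 : ℝ) + β)) ∧
          (∀ (κ μ : Fin d) (y : Site d) (j : ℕ), 1 ≤ j → j ≤ L ^ k →
            ‖Ad (((List.range j).map fun i : ℕ => rescale L (bavg L UB) (y + e κ + i • e μ) μ).prod)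
                  (Ad (rescale L (bavg L UB) (y + e κ + j • e μ) μ)
                      ((fun x μ => Ad (rescale L (bavg L UB) x μ)⁻¹ (iEta (((L : ℝ) ^ k)⁻¹) A x μ)) (y + (j + 1) • e μ) κ)
                    - (fun x μ => Ad (rescale L (bavg L UB) x μ)⁻¹ (iEta (((L : ℝ) ^ k)⁻¹) A x μ)) (y + j • e μ) κ)
              - (Ad (rescale L (bavg L UB) (y + e κ) μ) ((fun x μ => Ad (rescale L (bavg L UB) x μ)⁻¹ (iEta (((L : ℝ) ^ k)⁻¹) A x μ)) (y + e μ) κ)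
                - (fun x μ => Ad (rescale L (bavg L UB) x μ)⁻¹ (iEta (((L : ℝ) ^ k)⁻¹) A x μ)) y κ)‖
              ≤ s₂ * (((L : ℝ)⁻¹) ^ k) ^ ((2 : ℝ) + β) * (j : ℝ) ^ β) ∧
          (∀ (x : Site d) (κ : Fin d),
            ‖covLapDir (rescale L (bavg L UB)) (fun x μ => Ad (rescale L (bavg L UB) x μ)⁻¹ (iEta (((L : ℝ) ^ k)⁻¹) A x μ)) x κ‖
              ≤ s₁ * (((L : ℝ)⁻¹) ^ k) ^ 3))
    (h3 : LeafH3sup d L N ε b' c' dom) :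
    PairLandauGaugeB8AvgMS d (sfClass d L N ε) L N b g s₁ s₂ β dom := by
  intro k hk V hV UA UB hA hB hreg
  letI : CStarAlgebra (Matrix n n ℂ) := {}
  have hL1 : 1 ≤ L := le_trans (by norm_num) hL
  have hL1r : (1 : ℝ) ≤ L := by exact_mod_cast hL1
  have hLk : (1 : ℝ) ≤ (L : ℝ) ^ k := one_le_pow₀ hL1r
  obtain ⟨u, hu, huP, ⟨Λ, hΛ, hres⟩, A, hAsa, hAP, hmg, hs, hg, hlan, hhol, hMS, hlap⟩ := hOut k hk V hV UA UB hA hB hreg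
  set W : Site d → Fin d → (Matrix n n ℂ)ˣ := rescale L (bavg L UB) with hWdef
  set αW : ℝ := b' + 226 * (8 * (d + 1) * (d + 4)) ^ 2 * b' ^ 2 with hαWdef
  have hαW0 : 0 ≤ αW := by rw [hαWdef]; positivity
  -- the pair's background from (H3ˢᵘᵖ) at `U_B`: unitary, periodic, small-field of radius `α_W ξ²ᵏ`
  have hregB : RegularSup d L N b' c' (k + 1) UB := h3 V hV k UB hB
  have hbs' : 512 * (d + 1) * (d + 4) * (L : ℝ) ^ 2 * b' ≤ 1 := by
    have h1 : (512 : ℝ) * (d + 1) * (d + 4) * (L : ℝ) ^ 2 * b' ≤ 2 ^ 15 * ((d : ℝ) + 1) ^ 2 * ((d : ℝ) + 4) ^ 2 * (L : ℝ) ^ 2 * b' := by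
      have hd0 : (0 : ℝ) ≤ d := Nat.cast_nonneg d
      have : (512 : ℝ) * (d + 1) * (d + 4) ≤ 2 ^ 15 * ((d : ℝ) + 1) ^ 2 * ((d : ℝ) + 4) ^ 2 := by nlinarith
      have hL2b : 0 ≤ (L : ℝ) ^ 2 * b' := by positivity
      nlinarith
    linarith
  obtain ⟨hWu, hWP, hWsm⟩ := rescale_bavg_mem_sfClass hL1 hb' hbs' le_rfl hregB.regular
  -- `u₀ = ptw L W U_A k`: unitary and periodic
  obtain ⟨hAu, hAuP, hAsm⟩ := hA.mem.1
  have hG := avgClosed_unitaryUnits d (𝔸 := Matrix n n ℂ) L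
  have h34 : pdev UA < α * (((L : ℝ) ^ k)⁻¹) ^ 2 := by
    refine (pdev_le_of_smallField (div_nonneg hε (by positivity)) hAsm).trans_lt ?_
    rw [inv_pow, ← div_eq_mul_inv]; exact div_lt_div_of_pos_right hεα (by positivity)
  have h33 : pdev W < α * (((L : ℝ) ^ k)⁻¹) ^ 2 := by
    refine (pdev_le_of_smallField (div_nonneg hαW0 (by positivity)) hWsm).trans_lt ?_
    rw [inv_pow, ← div_eq_mul_inv]; exact div_lt_div_of_pos_right hb'α (by positivity)
  obtain ⟨hu₀G, -, -, -, -, -⟩ := pinnedTwistedFix_global L hL hG k W UA hWu hAu hα hα3 hα2 h33 h34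
  have hAshift : ∀ i : Fin d, shiftCfg (((N * L ^ k : ℕ) : ℤ) • e i) UA = UA := fun i => shiftCfg_of_isPeriodicCfg hAuP (e i)
  have hWshift : ∀ i : Fin d, shiftCfg (((N * L ^ k : ℕ) : ℤ) • e i) W = W := fun i => shiftCfg_of_isPeriodicCfg hWP (e i)
  have hu₀P : IsPeriodicSite (ptw L W UA k) ((N * L ^ k : ℕ) : ℤ) := fun x i => ptw_periodic hL1 N k hWshift hAshift x i
  -- the letters at `η = (Lᵏ)⁻¹`
  have hη : (0 : ℝ) < ((L : ℝ) ^ k)⁻¹ := by positivity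
  have hηk : ((L : ℝ) ^ k)⁻¹ = ((L : ℝ)⁻¹) ^ k := (inv_pow _ _).symm
  have hη1 : ((L : ℝ) ^ k)⁻¹ ≤ 1 := inv_le_one_of_one_le₀ hLk
  have hgrad' : (((L : ℝ) ^ k)⁻¹) ^ 2 * g' + 2 * (αW / ((L : ℝ) ^ k) ^ 2) * ((((L : ℝ) ^ k)⁻¹) * s) ≤ s₁ * (((L : ℝ) ^ k)⁻¹) ^ 2 := by
    have e : (((L : ℝ) ^ k)⁻¹) ^ 2 * g' + 2 * (αW / ((L : ℝ) ^ k) ^ 2) * ((((L : ℝ) ^ k)⁻¹) * s)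
        = (((L : ℝ) ^ k)⁻¹) ^ 2 * (g' + 2 * αW * s * ((L : ℝ) ^ k)⁻¹) := by
      field_simp
    rw [e, mul_comm s₁]
    refine mul_le_mul_of_nonneg_left ?_ (by positivity)
    have h1 : 2 * αW * s * ((L : ℝ) ^ k)⁻¹ ≤ 2 * αW * s := mul_le_of_le_one_right (by positivity) hη1
    linarith
  -- the Landau representative from the left chart (file 6 §1) and (1.37) from (1.29) (n16-b's g0 `PairDbarB8`)
  obtain ⟨hLR, htrans⟩ := landauRepB8_of_leftChart (s₂ := s₂) (β := β) rfl hWu hWP (div_nonneg hαW0 (by positivity)) hWsm hu huP hu₀G hu₀P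
    hη hηk hAsa hAP hmg hs hg hsup hgrad' rfl hlan hhol hlap
  exact ⟨u⁻¹ * ptw L W UA k, _, ⟨hLR, dbar_of_restr129_pair hd hL hA hB hreg hε hb hbs hα hεα hbα hα3 hα2 htrans hΛ hres⟩, hMS⟩

/-! ## §3 `PairLandauGaugeB8AvgMS` from (OUT₁₃₈-MS) -/

/-- **`PairLandauGaugeB8AvgMS` FROM (OUT₁₃₈-MS)** — §2 ∘ §1 (n16-a's `N16.pairLandauGaugeB8Avg_of_thm4OutputLandau138` with the multi-scale member carried): the
hypothesis of THE END's junction `N16HolderMSEnd.covRoot_holderMS_of_pairLandauGaugeB8AvgMS` from the output of file 29's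
`N16HolderMSPrintLetters.thm4OutputLandau138MS_of_thm4OutputPrintMS`. [folklore] -/
theorem pairLandauGaugeB8AvgMS_of_thm4OutputLandau138MS [Nonempty n] (hd : 1 ≤ d) {L N : ℕ} (hL : 2 ≤ L) (hN : 1 ≤ N) {ε b g b' c' α s g' s₁ s₂ β : ℝ}
    (hε : 0 ≤ ε) (hb : 0 ≤ b) (hbs : 512 * (d + 1) * (d + 4) * (L : ℝ) ^ 2 * b ≤ 1)
    (hbα : b + 226 * (8 * (d + 1) * (d + 4)) ^ 2 * b ^ 2 < α)
    (hb' : 0 ≤ b') (hRb : 2 ^ 15 * ((d : ℝ) + 1) ^ 2 * ((d : ℝ) + 4) ^ 2 * (L : ℝ) ^ 2 * b' ≤ 1)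
    (hb'α : b' + 226 * (8 * (d + 1) * (d + 4)) ^ 2 * b' ^ 2 < α)
    (hα : 0 < α) (hεα : ε < α) (hα3 : C0 d * α ≤ 1 / 3) (hα2 : 2 * α ≤ c2' d L)
    (hs0 : 0 ≤ s) (hsup : s ≤ s₁) (hgrad : g' + 2 * (b' + 226 * (8 * (d + 1) * (d + 4)) ^ 2 * b' ^ 2) * s ≤ s₁)
    {dom : Set (Site d → Fin d → (Matrix n n ℂ)ˣ)}
    (hOut : ∀ k : ℕ, 1 ≤ k → ∀ V ∈ dom, ∀ UA UB : Site d → Fin d → (Matrix n n ℂ)ˣ,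
      IsMinimiser d (sfClass d L N ε) L N k V UA → IsMinimiser d (sfClass d L N ε) L N (k + 1) V UB → Regular d L N b g (k + 1) UB →
      ∃ u : Site d → (Matrix n n ℂ)ˣ, (∀ x, u x ∈ unitaryUnits (Matrix n n ℂ)) ∧ IsPeriodicSite u ((N * L ^ k : ℕ) : ℤ) ∧
        (∃ Λ : ℕ → Set (Site d), Λ k = Set.univ ∧ Restr129 L k Λ (rescale L (bavg L UB)) u) ∧
        ∃ A : Site d → Fin d → Matrix n n ℂ,
          (∀ x μ, IsSelfAdjoint (A x μ)) ∧ (∀ (x : Site d) (κ μ : Fin d), A (x + ((N * L ^ k : ℕ) : ℤ) • e κ) μ = A x μ) ∧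
          mgauge (rescale L (bavg L UB)) u (cfgExp (((L : ℝ) ^ k)⁻¹) A)
            = pert (gaugeAct (ptw L (rescale L (bavg L UB)) UA k) UA) (rescale L (bavg L UB)) ∧
          (∀ x μ, ‖A x μ‖ ≤ s) ∧
          (∀ (μ : Fin d) (x : Site d) (κ : Fin d), ‖covDerivFwd (((L : ℝ) ^ k)⁻¹) (rescale L (bavg L UB)) μ (fun z => A z κ) x‖ ≤ g') ∧
          IsLandau138 L k (((L : ℝ) ^ k)⁻¹) Set.univ (torusLam k) (rescale L (bavg L UB)) A ∧
          (∀ (κ μ : Fin d) (y : Site d),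
            ‖Ad (rescale L (bavg L UB) (y + e κ) μ)
                (Ad (rescale L (bavg L UB) (y + e κ + e μ) μ)
                    ((fun x μ => Ad (rescale L (bavg L UB) x μ)⁻¹ (iEta (((L : ℝ) ^ k)⁻¹) A x μ)) (y + (2 : ℕ) • e μ) κ)
                  - (fun x μ => Ad (rescale L (bavg L UB) x μ)⁻¹ (iEta (((L : ℝ) ^ k)⁻¹) A x μ)) (y + e μ) κ)
              - (Ad (rescale L (bavg L UB) (y + e κ) μ) ((fun x μ => Ad (rescale L (bavg L UB) x μ)⁻¹ (iEta (((L : ℝ) ^ k)⁻¹) A x μ)) (y + e μ) κ)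
                - (fun x μ => Ad (rescale L (bavg L UB) x μ)⁻¹ (iEta (((L : ℝ) ^ k)⁻¹) A x μ)) y κ)‖
              ≤ s₂ * (((L : ℝ)⁻¹) ^ k) ^ ((2 : ℝ) + β)) ∧
          (∀ (κ μ : Fin d) (y : Site d) (j : ℕ), 1 ≤ j → j ≤ L ^ k →
            ‖Ad (((List.range j).map fun i : ℕ => rescale L (bavg L UB) (y + e κ + i • e μ) μ).prod)
                  (Ad (rescale L (bavg L UB) (y + e κ + j • e μ) μ)
                      ((fun x μ => Ad (rescale L (bavg L UB) x μ)⁻¹ (iEta (((L : ℝ) ^ k)⁻¹) A x μ)) (y + (j + 1) • e μ) κ)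
                    - (fun x μ => Ad (rescale L (bavg L UB) x μ)⁻¹ (iEta (((L : ℝ) ^ k)⁻¹) A x μ)) (y + j • e μ) κ)
              - (Ad (rescale L (bavg L UB) (y + e κ) μ) ((fun x μ => Ad (rescale L (bavg L UB) x μ)⁻¹ (iEta (((L : ℝ) ^ k)⁻¹) A x μ)) (y + e μ) κ)
                - (fun x μ => Ad (rescale L (bavg L UB) x μ)⁻¹ (iEta (((L : ℝ) ^ k)⁻¹) A x μ)) y κ)‖
              ≤ s₂ * (((L : ℝ)⁻¹) ^ k) ^ ((2 : ℝ) + β) * (j : ℝ) ^ β) ∧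
          (∀ (x : Site d) (κ : Fin d),
            ‖covLapDir (rescale L (bavg L UB)) (fun x μ => Ad (rescale L (bavg L UB) x μ)⁻¹ (iEta (((L : ℝ) ^ k)⁻¹) A x μ)) x κ‖
              ≤ s₁ * (((L : ℝ)⁻¹) ^ k) ^ 3))
    (h3 : LeafH3sup d L N ε b' c' dom) :
    PairLandauGaugeB8AvgMS d (sfClass d L N ε) L N b g s₁ s₂ β dom :=
  pairLandauGaugeB8AvgMS_of_thm4OutputMS hd hL hε hb hbs hbα hb' hRb hb'α hα hεα hα3 hα2 hs0 hsup hgrad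
    (thm4OutputMS_of_thm4OutputLandau138MS hL hN hb hbs hbα hα hα3 hα2 hOut) h3

end

end Summit.QuantumFields.YangMills.BalabanUVNodes.N16HolderMSOutputDict
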